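import Summits.CriticalPhenomena.PercolationContinuityZ3.Theorems.Transplant.SkelPhiFaceDataNbHist
import Summits.CriticalPhenomena.PercolationContinuityZ3.Theorems.Transplant.SkelNeg1ChoiceO
import HarnessLib

/-!
# N1 ({±1} node), (F) part 4 at the SMALL-ARRIVAL-BOX scheme (RULING B.15; hp-8 g33): `FaceOblAt` / `FaceOblAtM` of the scheme
# `⟨cellGeomSG₂b G (pr.ψ φ w₀) P w₀ Λ b₀, p, δc⟩` over the face's frame, witnessed by `faceStepWNb` (SMALL target `M_{a'}(x+du) ∪ Rim`), modulo the
# per-level kit clause — `SkelPhiFaceOblN` verbatim over parts 2b/3/3b-b (`b₀ ≤ 3r`)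

builds on p205010 (kernel theorem, internal audit signed; external expert review pending) — nothing in this file uses p205010; nothing here is a
claim about the open node `SamePDropOfSkeletonNeg`.
Lane `prim-bschramm`, seat `prim-hp-8` (gen 33); helper file (`--supports stmt-CriticalPhenomena-4575 --as helper`).
* **`faceOblAt_fineNb`**, **`faceOblAtM_fineNb`**.
[cite: KozmaNitzan2024, §4 p. 30 (Step III), Lemma 10 (p. 17), Lemma 12 (p. 24)] [cite: MartineauSevero2019, Cor. 2.2]
-/

noncomputable section

open MeasureTheory
open scoped Classical

namespace Summit.CriticalPhenomena.PercolationContinuityZ3.Theorems.Transplant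

namespace Skelφ

open Literature.Probability.Percolation Literature.Probability.LatticeModels SimpleGraph KNCells KNLevels GadgetSystem Contour
open Literature.Probability.Percolation.KozmaNitzan
open Literature.Probability.Percolation.KozmaNitzan.Cells (oth oth_ne sgOf sgOf_sign stepVec_apply_fst stepVec_apply_oth eq_oth_of_ne oth_oth)
open Literature.Barriers.CriticalPhenomena (graphBall graphBall_finite mem_graphBall_self graphBall_mono)
open BoxProdZ2 (ConcRadiiG)
open Skel (winGraph WinStepData excess)

variable {V : Type} [DecidableEq V] [Countable V] {G : SimpleGraph V} [G.LocallyFinite]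
variable {pr : FinePrm} {φ : V → Site 2} {P : PCells2} {w₀ : V} {Λ : ConcRadiiG} {b₀ : Fin 2 → ℕ} {b : Fin 2} {p : unitInterval} {δc : ℝ}
variable (hΛ : WFS2 P Λ) (hb₀ : ∀ i, b₀ i ≤ 3 * P.r i)
variable {h : ProbeHistory V} {e : Site 2 × MDir} (hV : (⟨cellGeomSG₂b G (pr.ψ φ w₀) P w₀ Λ b₀, p, δc⟩ : KSchA V ℕ).Valid₂ G h e) {a a' : ℕ} {du : MDir} (hdu : du ∈ (⟨cellGeomSG₂b G (pr.ψ φ w₀) P w₀ Λ b₀, p, δc⟩ : KSchA V ℕ).onward G h (tgt e))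
variable {j : ℕ} {o : Finset (Sym2 V)}

include hΛ hb₀ hV hdu

/-- **`FaceOblAt` over the face's frame for the fine-cell geometry of record, modulo the per-level kit clause.**  The step is `Skelφ.faceStepWN`
(window depth `rE_{a'}(x,du)`, frame levels about the face box `[loN, hiN]`, region the frame window over `DplN` inside the cell-map window over
`farAS₂`, target `M_{a'}(x+du) ∪ Rim`, levels `[M+1, Rlev]`, source the root, support `Sx`); every non-kit clause is discharged by parts 2–3.
[cite: KozmaNitzan2024, §4 p. 30 (Step III), Lemma 10 (p. 17), Lemma 12 (p. 24)] -/
theorem faceOblAt_fineNb (hlipψ : Lip G (pr.ψ φ w₀)) (hws : WeakSteps G (pr.ψ φ w₀)) (hlipF : Lip G (pr.frame φ w₀ du.1 b))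
    (hc₀ : 0 < pr.c₀) (hc₁ : 0 < pr.c₁) (hD : 0 < pr.D) (hM : pr.A * TwoAxis.Para.modulus pr.n pr.h pr.vα pr.vβ ≠ 0)
    (hnz : pr.lvGen du.1 b ≠ 0) (hjK : j + 1 ≤ P.K) {Δ' Rlev N M L' : ℕ} {δ₂ : ℝ} {pc : ℤ} {aw : ℕ} {yF : V}
    (hyF : pr.ψ φ w₀ yF = P.faceCen (tgt e) du j) (hpc : pc = relφ φ w₀ yF b)
    (hRlev : Rlev + 4 ≤ 10 * P.s du.1) (hRlev' : Rlev + 4 ≤ 3 * P.r (oth du.1))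
    {k₀ : ℤ} (hk₀ : pr.rdN du.1 b ≤ pr.rdK du.1 b * k₀) (hk₀' : 3 * (P.r (oth du.1) : ℤ) + k₀ + 3 ≤ 5 * P.r (oth du.1))
    {kF : ℤ} (hroomF : pr.Mabs * (aw + Rlev + 1) + pr.rdN du.1 b * (Rlev + 2) * pr.D ≤ pr.rdK du.1 b * kF * pr.D)
    (hkF : kF + 3 ≤ 5 * P.r (oth du.1))
    (haw : (pr.rdK 1 b * (P.faceExt du 0 + 1) + pr.rdK 0 b * (P.faceExt du 1 + 1)) * pr.D ≤ pr.Mabs * (aw + 1))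
    (hcount : 1 / (1 - (p : ℝ)) ^ (Δ' * N) ≤ δ₂ * ((Finset.Icc (M + 1) Rlev).card : ℝ))
    (hMne : ((⟨cellGeomSG₂b G (pr.ψ φ w₀) P w₀ Λ b₀, p, δc⟩ : KSchA V ℕ).Γ.M a' (tgt e + stepVec du)).Nonempty)
    (hkits : let Q := faceStepWNb G pr φ P w₀ Λ b₀ b a' (tgt e) du j pc aw Rlev N M L' ((⟨cellGeomSG₂b G (pr.ψ φ w₀) P w₀ Λ b₀, p, δc⟩ : KSchA V ℕ).Sx G h e a a' du)
      ∀ j' ∈ Finset.Icc Q.j₀ Q.j₁, ∃ (σ : KNLevels.SData V) (Sz : Finset V),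
        KNLevels.SHyp (winLData G (pr.frame φ w₀ du.1 b) Q.root Q.Rπ Q.lo Q.hi Q.root Q.Sfin) j' σ ∧ σ.N ≤ Q.N ∧
        (1 - (p : ℝ) ^ σ.sB) ^ σ.k ≤ δ₂ ∧ Sz ⊆ (winLData G (pr.frame φ w₀ du.1 b) Q.root Q.Rπ Q.lo Q.hi Q.root Q.Sfin).X j' ∧
        Sz ⊆ stepRg G (pr.frame φ w₀ du.1 b) Q ∧
        (∀ x ∈ σ.K, ∀ e' ∈ σ.seed x, e' ∉ wireSet (↑Sz : Set V)) ∧ (∀ x ∈ σ.K, σ.face x ⊆ Sz) ∧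
        (∀ x ∈ σ.K, 1 - 3 * δ₂ ≤ (prodBernoulli ((⟨cellGeomSG₂b G (pr.ψ φ w₀) P w₀ Λ b₀, p, δc⟩ : KSchA V ℕ).Wt G h e a a' du j o)).real {ω | ∃ u ∈ σ.face x,
          1 - δ₂ < (prodBernoulli (pinW ((⟨cellGeomSG₂b G (pr.ψ φ w₀) P w₀ Λ b₀, p, δc⟩ : KSchA V ℕ).Wt G h e a a' du j o) (wireSet (↑Sz : Set V)) ω)).real
            (⋃ t ∈ Q.T, openConnIn (↑(stepRg G (pr.frame φ w₀ du.1 b) Q) : Set V) u t)}))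
    {R₀ : ℕ} (hQ : Λ.rQ a (tgt e) ≤ R₀) (hρ : ∀ ℓ, Λ.ρ a' (tgt e) du ℓ ≤ R₀) {η : ℝ} (hη : η ≤ δc / 2)
    {φ' : V → Site 2} {m R₁ : ℕ}
    (hR₁ : ∀ R', R₁ ≤ R' → ∀ (Rw : ℕ) (D' A' : Finset V), (∀ d ∈ D', d ∈ graphBall G w₀ Rw) →
      (∀ d ∈ D', ∀ d' ∈ D', φ' d - φ' d' ∈ box 2 m) → A' ⊆ D' → (∀ a ∈ A', a ∈ graphBall G w₀ (R₀ + 1)) →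
        (bondPercolation G p).real (excess G w₀ R' D' A') ≤ η)
    (hR : R₁ ≤ Λ.rM a' (tgt e + stepVec du) - L')
    (hdiam : ∀ d ∈ (⟨cellGeomSG₂b G (pr.ψ φ w₀) P w₀ Λ b₀, p, δc⟩ : KSchA V ℕ).Γ.Efar a' (tgt e) du, ∀ d' ∈ (⟨cellGeomSG₂b G (pr.ψ φ w₀) P w₀ Λ b₀, p, δc⟩ : KSchA V ℕ).Γ.Efar a' (tgt e) du, φ' d - φ' d' ∈ box 2 m) :
    FaceOblAt G (pr.frame φ w₀ du.1 b) (⟨cellGeomSG₂b G (pr.ψ φ w₀) P w₀ Λ b₀, p, δc⟩ : KSchA V ℕ) (faceDataSG G (pr.ψ φ w₀) P w₀ Λ) Δ' δ₂ h e a a' du j o := by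
  have hexc := rim_excess_faceStepWNb hΛ hb₀ hV hdu (j := j) (o := o) pc aw Rlev N M L' (b := b) hlipψ hws hQ hρ hR₁ hR hdiam
  have hsub := isSubbox_faceStepWNb hΛ hb₀ hV hdu (a := a) (a' := a') (j := j) (o := o) pc aw Rlev N M L' (b := b) hlipψ hws
  have hRgS := faceStepWNb_Rg_subset_Sfin (b₀ := b₀) (p := p) (δc := δc) hΛ (h := h) (e := e) (a := a) (a' := a') (du := du) (j := j) pc aw Rlev N M L'
    (b := b) hlipψ hws
  have hroot := faceStepWNb_root_eq (G := G) (pr := pr) (φ := φ) (P := P) (w₀ := w₀) (Λ := Λ) (b₀ := b₀) (p := p) (δc := δc) (h := h)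
    (e := e) (a := a) (a' := a') (du := du) (j := j) pc aw Rlev N M L' (b := b)
  have ho := root_not_mem_faceStepWNb_Rg hΛ hb₀ hV hdu (a := a) (a' := a') (j := j) pc aw Rlev N M L' (b := b) hlipψ hws
  have hoS := root_mem_faceStepWNb_Sfin (pr := pr) (φ := φ) hV (P := P) (w₀ := w₀) (Λ := Λ) (b := b) (a := a) (a' := a') (du := du)
    (j := j) pc aw Rlev N M L'
  refine ⟨faceStepWNb G pr φ P w₀ Λ b₀ b a' (tgt e) du j pc aw Rlev N M L' ((⟨cellGeomSG₂b G (pr.ψ φ w₀) P w₀ Λ b₀, p, δc⟩ : KSchA V ℕ).Sx G h e a a' du),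
    (cellGeomSG₂b G (pr.ψ φ w₀) P w₀ Λ b₀).M a' (tgt e + stepVec du), η, hroot, hsub, finSupp_faceStepWNb pc aw Rlev N M L', hRgS,
    faceStepWNb_encl G φ P w₀ Λ b₀ a' hyF hpc hjK hRlev hRlev' hc₀ hc₁ hD hnz hroomF hkF N M L' _, ho, hoS, le_rfl,
    faceStepWNb_T_subset_Rg G φ P w₀ b₀ a' pc aw Rlev N M L' _ hΛ.toWF2 hb₀ (by omega) hlipF hc₀ hc₁ hD hnz hk₀ hk₀',
    faceStepWNb_T_nonempty G pr φ P w₀ Λ b₀ b a' (tgt e) du j pc aw Rlev N M L' _ hMne,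
    hcount, hkits, Finset.subset_union_left, subset_rfl, hexc, hη, ?_⟩
  exact Face_subset_faceStepWNb_X_zero G φ P w₀ b₀ a' hΛ.toWF2 hyF hpc hM hc₀ hc₁ hD haw Rlev N M L' _

/-- **The face obligation with the window map chosen per face** (p3-g8's `FaceOblAtM`, p282003), witnessed by the face's frame
`pr.frame φ w₀ du.1 b`. [cite: KozmaNitzan2024, §4 p. 30 (Step III)] -/
theorem faceOblAtM_fineNb (hlipψ : Lip G (pr.ψ φ w₀)) (hws : WeakSteps G (pr.ψ φ w₀)) (hlipF : Lip G (pr.frame φ w₀ du.1 b))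
    (hc₀ : 0 < pr.c₀) (hc₁ : 0 < pr.c₁) (hD : 0 < pr.D) (hM : pr.A * TwoAxis.Para.modulus pr.n pr.h pr.vα pr.vβ ≠ 0)
    (hnz : pr.lvGen du.1 b ≠ 0) (hjK : j + 1 ≤ P.K) {Δ' Rlev N M L' : ℕ} {δ₂ : ℝ} {pc : ℤ} {aw : ℕ} {yF : V}
    (hyF : pr.ψ φ w₀ yF = P.faceCen (tgt e) du j) (hpc : pc = relφ φ w₀ yF b)
    (hRlev : Rlev + 4 ≤ 10 * P.s du.1) (hRlev' : Rlev + 4 ≤ 3 * P.r (oth du.1))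
    {k₀ : ℤ} (hk₀ : pr.rdN du.1 b ≤ pr.rdK du.1 b * k₀) (hk₀' : 3 * (P.r (oth du.1) : ℤ) + k₀ + 3 ≤ 5 * P.r (oth du.1))
    {kF : ℤ} (hroomF : pr.Mabs * (aw + Rlev + 1) + pr.rdN du.1 b * (Rlev + 2) * pr.D ≤ pr.rdK du.1 b * kF * pr.D)
    (hkF : kF + 3 ≤ 5 * P.r (oth du.1))
    (haw : (pr.rdK 1 b * (P.faceExt du 0 + 1) + pr.rdK 0 b * (P.faceExt du 1 + 1)) * pr.D ≤ pr.Mabs * (aw + 1))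
    (hcount : 1 / (1 - (p : ℝ)) ^ (Δ' * N) ≤ δ₂ * ((Finset.Icc (M + 1) Rlev).card : ℝ))
    (hMne : ((⟨cellGeomSG₂b G (pr.ψ φ w₀) P w₀ Λ b₀, p, δc⟩ : KSchA V ℕ).Γ.M a' (tgt e + stepVec du)).Nonempty)
    (hkits : let Q := faceStepWNb G pr φ P w₀ Λ b₀ b a' (tgt e) du j pc aw Rlev N M L' ((⟨cellGeomSG₂b G (pr.ψ φ w₀) P w₀ Λ b₀, p, δc⟩ : KSchA V ℕ).Sx G h e a a' du)
      ∀ j' ∈ Finset.Icc Q.j₀ Q.j₁, ∃ (σ : KNLevels.SData V) (Sz : Finset V),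
        KNLevels.SHyp (winLData G (pr.frame φ w₀ du.1 b) Q.root Q.Rπ Q.lo Q.hi Q.root Q.Sfin) j' σ ∧ σ.N ≤ Q.N ∧
        (1 - (p : ℝ) ^ σ.sB) ^ σ.k ≤ δ₂ ∧ Sz ⊆ (winLData G (pr.frame φ w₀ du.1 b) Q.root Q.Rπ Q.lo Q.hi Q.root Q.Sfin).X j' ∧
        Sz ⊆ stepRg G (pr.frame φ w₀ du.1 b) Q ∧
        (∀ x ∈ σ.K, ∀ e' ∈ σ.seed x, e' ∉ wireSet (↑Sz : Set V)) ∧ (∀ x ∈ σ.K, σ.face x ⊆ Sz) ∧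
        (∀ x ∈ σ.K, 1 - 3 * δ₂ ≤ (prodBernoulli ((⟨cellGeomSG₂b G (pr.ψ φ w₀) P w₀ Λ b₀, p, δc⟩ : KSchA V ℕ).Wt G h e a a' du j o)).real {ω | ∃ u ∈ σ.face x,
          1 - δ₂ < (prodBernoulli (pinW ((⟨cellGeomSG₂b G (pr.ψ φ w₀) P w₀ Λ b₀, p, δc⟩ : KSchA V ℕ).Wt G h e a a' du j o) (wireSet (↑Sz : Set V)) ω)).real
            (⋃ t ∈ Q.T, openConnIn (↑(stepRg G (pr.frame φ w₀ du.1 b) Q) : Set V) u t)}))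
    {R₀ : ℕ} (hQ : Λ.rQ a (tgt e) ≤ R₀) (hρ : ∀ ℓ, Λ.ρ a' (tgt e) du ℓ ≤ R₀) {η : ℝ} (hη : η ≤ δc / 2)
    {φ' : V → Site 2} {m R₁ : ℕ}
    (hR₁ : ∀ R', R₁ ≤ R' → ∀ (Rw : ℕ) (D' A' : Finset V), (∀ d ∈ D', d ∈ graphBall G w₀ Rw) →
      (∀ d ∈ D', ∀ d' ∈ D', φ' d - φ' d' ∈ box 2 m) → A' ⊆ D' → (∀ a ∈ A', a ∈ graphBall G w₀ (R₀ + 1)) →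
        (bondPercolation G p).real (excess G w₀ R' D' A') ≤ η)
    (hR : R₁ ≤ Λ.rM a' (tgt e + stepVec du) - L')
    (hdiam : ∀ d ∈ (⟨cellGeomSG₂b G (pr.ψ φ w₀) P w₀ Λ b₀, p, δc⟩ : KSchA V ℕ).Γ.Efar a' (tgt e) du, ∀ d' ∈ (⟨cellGeomSG₂b G (pr.ψ φ w₀) P w₀ Λ b₀, p, δc⟩ : KSchA V ℕ).Γ.Efar a' (tgt e) du, φ' d - φ' d' ∈ box 2 m) :
    FaceOblAtM G (⟨cellGeomSG₂b G (pr.ψ φ w₀) P w₀ Λ b₀, p, δc⟩ : KSchA V ℕ) (faceDataSG G (pr.ψ φ w₀) P w₀ Λ) Δ' δ₂ h e a a' du j o :=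
  ⟨pr.frame φ w₀ du.1 b, hlipF, faceOblAt_fineNb hΛ hb₀ hV hdu hlipψ hws hlipF hc₀ hc₁ hD hM hnz hjK hyF hpc hRlev hRlev' hk₀ hk₀' hroomF hkF
    haw hcount hMne hkits hQ hρ hη hR₁ hR hdiam⟩

end Skelφ

end Summit.CriticalPhenomena.PercolationContinuityZ3.Theorems.Transplant

end
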